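import Summits.QuantumFields.YangMills.Theorems.ParabolicTrajectoryLatticeGapOnTrajectorySlabClusteringKernels
import Summits.QuantumFields.YangMills.Theorems.ParabolicTrajectoryLatticeGapOnTrajectoryStubTorusFrames
import HarnessLib

/-!
# Crux `LatticeGapOnTrajectory` (stmt-QuantumFields-10523), line `orbit-kantorovich-finite-size`:
# the kernels of Wilson's torus specification — Gibbs ratios, finite range, TV-Lipschitz bound
# (slab clustering, part 2)

Helper file (`--supports stmt-QuantumFields-10523`) for the registered stub `stub_slabClustering`
(G-blind plumbing; nothing about mass gaps is asserted, everything here is proved).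

* §3 The kernels `γ_Λ(· | η)` of `torusYM` as Gibbs ratios over product Haar measure on `Λ`
  (`windowAvg_torusYM_eq`), their sup bound, their FINITE RANGE (`dependsOn_windowAvg_torusYM`: the
  boundary condition is read only on the links of plaquettes touching `Λ` — the plaquettes not
  touching `Λ` cancel in the normalisation), and their invariance under gauge transformations
  trivial at the endpoints of `Λ` (`windowAvg_torusYM_gaugeTransform`).
* §4 The TV-LIPSCHITZ bound in the capped orbit weight (`abs_windowAvg_sub_le_orbitWeight`, the
  registered helper): for a cell `y` carrying no link of `Λ` and boundary conditions `η, η'` equal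
  off `y`, `|γ_Λ f(η) − γ_Λ f(η')| ≤ 2B(1 + 2e²|β|α·P_y) · orbitWeight r α q y η η'`,
  `P_y = 4·#{plaquettes based in the shadow of y}`; the frame bound `P_y ≤ 7680 b⁴`
  (`plaqCount_le`) and the resulting bound for frames of scale `b`
  (`abs_windowAvg_sub_le_orbitWeight_frame`).

References: Georgii 2011 §8.2; Seiler LNP 159 Ch. 1 (gauge invariance of `S_W`); Dobrushin–Shlosman
1985 (the one-cell total-variation bound as the input of the finite-size criterion).
-/

namespace Summit.QuantumFields.YangMills.Cruxes.LatticeGapOnTrajectory.OrbitKantorovichFiniteSize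

open scoped BigOperators ENNReal
open Filter MeasureTheory
open Literature.Probability.LatticeModels (Specification glueWith glueWith_apply_mem
  glueWith_apply_not_mem measurable_glueWith)
open Literature.MathematicalPhysics.QuantumFieldTheory

noncomputable section

namespace SlabClustering

/-! ### §3 The kernels of Wilson's torus specification -/

section Torus

variable {G : Type} [Group G] [TopologicalSpace G] [IsTopologicalGroup G] [CompactSpace G]
  [MeasurableSpace G] [BorelSpace G] (r : LatticeRep G) {L : ℕ} [NeZero L]

/-- **The kernels of `torusYM` as Gibbs ratios** over product Haar measure on the links of `Λ`:
`γ_Λ f(η) = ∫ e^{-βS(ζη)} f(ζη) dζ / ∫ e^{-βS(ζη)} dζ` (`ζη = glueWith Λ ζ η`). -/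
theorem windowAvg_torusYM_eq (β : ℝ) (Λ : Finset (Edge 4 L)) {f : GaugeConfig 4 L G → ℝ}
    (hf : Measurable f) (η : GaugeConfig 4 L G) :
    windowAvg (torusYM r.ρ β L) Λ f η =
      (∫ ζ, Real.exp (-β * wilsonAction r.ρ (glueWith Λ ζ η)) * f (glueWith Λ ζ η)
          ∂Measure.pi fun _ : ↥Λ => haarProbability G) /
        ∫ ζ, Real.exp (-β * wilsonAction r.ρ (glueWith Λ ζ η))
          ∂Measure.pi fun _ : ↥Λ => haarProbability G := by
  haveI : SecondCountableTopology G :=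
    (r.continuous.isClosedEmbedding r.injective).isEmbedding.secondCountableTopology
  have hSm : Measurable fun U : GaugeConfig 4 L G => -β * wilsonAction r.ρ U :=
    (measurable_wilsonAction r.ρ r.continuous).const_mul _
  have hg := (measurable_glueWith (S := G) Λ η).aemeasurable
    (μ := Measure.pi fun _ : ↥Λ => haarProbability G)
  unfold windowAvg torusYM
  rw [integral_tilted, integral_map hg hSm.exp.aestronglyMeasurable, integral_map hg]
  · simp_rw [smul_eq_mul, div_mul_eq_mul_div]
    rw [integral_div]
  · exact ((hSm.exp.div_const _).smul hf).aestronglyMeasurable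

/-- The kernels of `torusYM` are bounded by the sup norm of the integrand. -/
theorem abs_windowAvg_torusYM_le (β : ℝ) (Λ : Finset (Edge 4 L)) {f : GaugeConfig 4 L G → ℝ}
    (hf : Measurable f) {B : ℝ} (hfb : ∀ U, |f U| ≤ B) (η : GaugeConfig 4 L G) :
    |windowAvg (torusYM r.ρ β L) Λ f η| ≤ B := by
  haveI : SecondCountableTopology G :=
    (r.continuous.isClosedEmbedding r.injective).isEmbedding.secondCountableTopology
  obtain ⟨C, hC⟩ := exists_abs_wilsonAction_le (d := 4) (L := L) r.ρ r.continuous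
  rw [windowAvg_torusYM_eq r β Λ hf η]
  refine abs_gibbsRatio_le _ (C := |β| * C) ?_ (hf.comp (measurable_glueWith Λ η)) ?_ fun ζ => hfb _
  · exact ((measurable_wilsonAction r.ρ r.continuous).comp (measurable_glueWith Λ η)).const_mul _
  · intro ζ
    rw [abs_mul, abs_neg]
    exact mul_le_mul_of_nonneg_left (hC _) (abs_nonneg β)

/-- **Finite range of Wilson's torus specification.** If every plaquette based in the shadow of
`Λ` has all its links in `Λ ∪ T`, and `f` reads only the links of `Λ`, then `γ_Λ f` reads the
boundary condition only on `T` (the plaquettes not touching `Λ` cancel in the normalisation). -/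
theorem dependsOn_windowAvg_torusYM (β : ℝ) (Λ : Finset (Edge 4 L)) {T : Set (Edge 4 L)}
    (hT : ∀ p : Plaquette 4 L, p.1 ∈ edgeShadow Λ →
      ((p.1, p.2.1.1) ∈ Λ ∨ (p.1, p.2.1.1) ∈ T) ∧
        ((p.1.shift p.2.1.1, p.2.1.2) ∈ Λ ∨ (p.1.shift p.2.1.1, p.2.1.2) ∈ T) ∧
        ((p.1.shift p.2.1.2, p.2.1.1) ∈ Λ ∨ (p.1.shift p.2.1.2, p.2.1.1) ∈ T) ∧
        ((p.1, p.2.1.2) ∈ Λ ∨ (p.1, p.2.1.2) ∈ T))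
    {f : GaugeConfig 4 L G → ℝ} (hf : Measurable f) (hfdep : DependsOn f (↑Λ : Set (Edge 4 L))) :
    DependsOn (windowAvg (torusYM r.ρ β L) Λ f) T := by
  intro η η' hηη'
  rw [windowAvg_torusYM_eq r β Λ hf, windowAvg_torusYM_eq r β Λ hf]
  have hsplit : ∀ (θ : GaugeConfig 4 L G) (ζ : ↥Λ → G),
      Real.exp (-β * wilsonAction r.ρ (glueWith Λ ζ θ)) =
        Real.exp (-β * bulkAction r.ρ (edgeShadow Λ) θ) *
          Real.exp (-β * shadowAction r.ρ (edgeShadow Λ) (glueWith Λ ζ θ)) := by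
    intro θ ζ
    rw [wilsonAction_eq_shadowAction_add_bulkAction r.ρ (edgeShadow Λ),
      bulkAction_congr r.ρ (fun e he => glueWith_apply_not_mem Λ ζ θ he), ← Real.exp_add]
    ring_nf
  have hglue : ∀ (ζ : ↥Λ → G) (e : Edge 4 L), e ∈ Λ ∨ e ∈ T →
      glueWith Λ ζ η e = glueWith Λ ζ η' e := by
    intro ζ e he
    by_cases heΛ : e ∈ Λ
    · rw [glueWith_apply_mem _ _ _ heΛ, glueWith_apply_mem _ _ _ heΛ]
    · rw [glueWith_apply_not_mem _ _ _ heΛ, glueWith_apply_not_mem _ _ _ heΛ]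
      exact hηη' e (he.resolve_left heΛ)
  have hsh : ∀ ζ : ↥Λ → G, shadowAction r.ρ (edgeShadow Λ) (glueWith Λ ζ η) =
      shadowAction r.ρ (edgeShadow Λ) (glueWith Λ ζ η') := fun ζ =>
    shadowAction_congr r fun p hp =>
      ⟨hglue ζ _ (hT p hp).1, hglue ζ _ (hT p hp).2.1, hglue ζ _ (hT p hp).2.2.1,
        hglue ζ _ (hT p hp).2.2.2⟩
  have hfg : ∀ ζ : ↥Λ → G, f (glueWith Λ ζ η) = f (glueWith Λ ζ η') :=
    fun ζ => hfdep fun e he => hglue ζ e (Or.inl (Finset.mem_coe.1 he))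
  simp_rw [hsplit, mul_assoc]
  rw [integral_const_mul, integral_const_mul, integral_const_mul, integral_const_mul,
    mul_div_mul_left _ _ (Real.exp_ne_zero _), mul_div_mul_left _ _ (Real.exp_ne_zero _)]
  simp_rw [hsh, hfg]

/-- **Gauge reduction.** A gauge transformation trivial at both endpoints of every link of `Λ` does
not change `γ_Λ f(η)` for `f` reading only `Λ` (`S_W` is gauge invariant and gluing commutes with
the transformation). -/
theorem windowAvg_torusYM_gaugeTransform (β : ℝ) (Λ : Finset (Edge 4 L))
    {f : GaugeConfig 4 L G → ℝ} (hf : Measurable f) (hfdep : DependsOn f (↑Λ : Set (Edge 4 L)))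
    {g : Site 4 L → G} (hg : ∀ e ∈ Λ, g e.1 = 1 ∧ g (e.1.shift e.2) = 1) (η : GaugeConfig 4 L G) :
    windowAvg (torusYM r.ρ β L) Λ f (gaugeTransform g η) = windowAvg (torusYM r.ρ β L) Λ f η := by
  rw [windowAvg_torusYM_eq r β Λ hf, windowAvg_torusYM_eq r β Λ hf]
  have hglue : ∀ ζ : ↥Λ → G, glueWith Λ ζ (gaugeTransform g η) = gaugeTransform g (glueWith Λ ζ η) := by
    intro ζ
    funext e
    by_cases he : e ∈ Λ
    · rw [glueWith_apply_mem _ _ _ he, gaugeTransform_apply_of_eq_one (hg e he).1 (hg e he).2,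
        glueWith_apply_mem _ _ _ he]
    · rw [glueWith_apply_not_mem _ _ _ he]
      simp only [gaugeTransform]
      rw [glueWith_apply_not_mem _ _ _ he]
  have hS : ∀ ζ : ↥Λ → G, wilsonAction r.ρ (glueWith Λ ζ (gaugeTransform g η)) =
      wilsonAction r.ρ (glueWith Λ ζ η) := fun ζ => by rw [hglue, wilsonAction_gaugeTransform]
  have hf' : ∀ ζ : ↥Λ → G, f (glueWith Λ ζ (gaugeTransform g η)) = f (glueWith Λ ζ η) :=
    fun ζ => hfdep fun e he => by
      rw [glueWith_apply_mem _ _ _ (Finset.mem_coe.1 he), glueWith_apply_mem _ _ _ (Finset.mem_coe.1 he)]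
  simp_rw [hS, hf']

end Torus

/-! ### §4 The TV-Lipschitz bound in the capped orbit weight -/

section OrbitLip

variable {G : Type} [Group G] [TopologicalSpace G] [IsTopologicalGroup G] [CompactSpace G]
  [MeasurableSpace G] [BorelSpace G] (r : LatticeRep G) {L : ℕ} [NeZero L] {μ : Fin 4 → ℕ}

omit [TopologicalSpace G] [IsTopologicalGroup G] [CompactSpace G] [MeasurableSpace G]
  [BorelSpace G] [NeZero L] in
/-- An interior gauge transformation of the cell `c` is trivial at both endpoints of every link
outside `c` (an interior site has all its incident links in `c`). -/
theorem interiorGauge_apply_eq_one {q : (i : Fin 4) → ZMod L → ZMod (μ i + 1)} {c : CoarseIdx μ}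
    {g : Site 4 L → G} (hg : IsInteriorGauge q c g) {e : Edge 4 L} (he : cellOf q e ≠ c) :
    g e.1 = 1 ∧ g (e.1.shift e.2) = 1 := by
  refine ⟨hg _ fun h => he h.1, hg _ fun h => he ?_⟩
  have h2 := h.2 e.2
  rwa [Site.shift, add_sub_cancel_right] at h2

omit [IsTopologicalGroup G] [CompactSpace G] [MeasurableSpace G] [BorelSpace G] [NeZero L] in
/-- `cellDev ≥ 0`. -/
theorem cellDev_nonneg (q : (i : Fin 4) → ZMod L → ZMod (μ i + 1)) (c : CoarseIdx μ)
    (U U' : GaugeConfig 4 L G) : 0 ≤ cellDev r q c U U' :=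
  Real.iInf_nonneg fun _ => Real.iSup_nonneg fun _ => repDist_nonneg r _ _

/-- **TV-Lipschitz bound of Wilson's kernels in the capped orbit weight.** For a cell `y` carrying
no link of `Λ`, a bounded measurable `f` reading only `Λ`, and boundary conditions `η, η'` equal off
`y`: `|γ_Λ f(η) − γ_Λ f(η')| ≤ 2B(1 + 2e²|β|α·plaqCount) · orbitWeight r α q y η η'`. Interior gauge
transformations of `y` do not change `γ_Λ f` (`windowAvg_torusYM_gaugeTransform`), the energies of
two linkwise `s`-close boundary conditions differ by `≤ |β|·plaqCount·s` (`abs_wilsonAction_sub_le`),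
so `|Δ| ≤ 4e²B|β|·plaqCount·cellDev` (`abs_gibbsRatio_sub_le_linear`, infimum over the gauge);
together with the trivial bound `2B` this is dominated by the capped weight `min(1, cellDev/α)`. -/
theorem abs_windowAvg_sub_le_orbitWeight (β α : ℝ) (hα : 0 < α)
    (q : (i : Fin 4) → ZMod L → ZMod (μ i + 1)) (Λ : Finset (Edge 4 L)) (y : CoarseIdx μ)
    (hy : ∀ e ∈ Λ, cellOf q e ≠ y) {P : ℝ}
    (hP : 4 * ((Finset.univ.filter fun p : Plaquette 4 L =>
      p.1 ∈ edgeShadow (Finset.univ.filter fun e : Edge 4 L => cellOf q e = y)).card : ℝ) ≤ P)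
    {f : GaugeConfig 4 L G → ℝ} (hf : Measurable f)
    (hfdep : DependsOn f (↑Λ : Set (Edge 4 L))) {B : ℝ} (hfb : ∀ U, |f U| ≤ B)
    (η η' : GaugeConfig 4 L G) (hηη' : ∀ e, cellOf q e ≠ y → η e = η' e) :
    |windowAvg (torusYM r.ρ β L) Λ f η - windowAvg (torusYM r.ρ β L) Λ f η'| ≤
      2 * B * (1 + 2 * Real.exp 2 * |β| * α * P) * orbitWeight r α q y η η' := by
  classical
  have hP0 : 0 ≤ P := le_trans (by positivity) hP
  haveI : SecondCountableTopology G :=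
    (r.continuous.isClosedEmbedding r.injective).isEmbedding.secondCountableTopology
  have hB : 0 ≤ B := (abs_nonneg _).trans (hfb fun _ => 1)
  set D := cellDev r q y η η' with hDdef
  have hD0 : 0 ≤ D := cellDev_nonneg r q y η η'
  set Cst : ℝ := 4 * Real.exp 2 * B * (|β| * P) with hCst
  have hCst0 : 0 ≤ Cst := by positivity
  -- the bound through a near-optimal interior gauge transformation
  have key : ∀ ε : ℝ, 0 < ε →
      |windowAvg (torusYM r.ρ β L) Λ f η - windowAvg (torusYM r.ρ β L) Λ f η'| ≤ Cst * (D + ε) := by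
    intro ε hε
    haveI : Nonempty {g : Site 4 L → G // IsInteriorGauge q y g} := ⟨⟨fun _ => 1, fun _ _ => rfl⟩⟩
    have hlt : cellDev r q y η η' < D + ε := by rw [← hDdef]; exact lt_add_of_pos_right D hε
    unfold cellDev at hlt
    obtain ⟨⟨g, hg⟩, hgε⟩ := exists_lt_of_ciInf_lt hlt
    set η'' : GaugeConfig 4 L G := gaugeTransform g η' with hη''
    set s : ℝ := ⨆ e : {e : Edge 4 L // cellOf q e = y}, repDist r (η e.1) (η'' e.1) with hsdef
    have hs_lt : s < D + ε := hgε
    have hse : ∀ e : Edge 4 L, cellOf q e = y → repDist r (η e) (η'' e) ≤ s := fun e he =>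
      le_ciSup (f := fun e : {e : Edge 4 L // cellOf q e = y} => repDist r (η e.1) (η'' e.1))
        (Set.finite_range _).bddAbove ⟨e, he⟩
    have hs0 : 0 ≤ s := Real.iSup_nonneg fun _ => repDist_nonneg r _ _
    have hoff : ∀ e : Edge 4 L, cellOf q e ≠ y → η e = η'' e := fun e he => by
      obtain ⟨h1, h2⟩ := interiorGauge_apply_eq_one hg he
      rw [hηη' e he, hη'', gaugeTransform_apply_of_eq_one h1 h2]
    have hwa : windowAvg (torusYM r.ρ β L) Λ f η'' = windowAvg (torusYM r.ρ β L) Λ f η' :=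
      windowAvg_torusYM_gaugeTransform r β Λ hf hfdep
        (fun e he => interiorGauge_apply_eq_one hg (hy e he)) η'
    rw [← hwa, windowAvg_torusYM_eq r β Λ hf, windowAvg_torusYM_eq r β Λ hf]
    have hfg : ∀ ζ : ↥Λ → G, f (glueWith Λ ζ η'') = f (glueWith Λ ζ η) := fun ζ =>
      hfdep fun e he => by
        rw [glueWith_apply_mem _ _ _ (Finset.mem_coe.1 he), glueWith_apply_mem _ _ _ (Finset.mem_coe.1 he)]
    simp_rw [hfg]
    obtain ⟨C, hC⟩ := exists_abs_wilsonAction_le (d := 4) (L := L) r.ρ r.continuous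
    have hSm : ∀ θ : GaugeConfig 4 L G,
        Measurable fun ζ : ↥Λ → G => -β * wilsonAction r.ρ (glueWith Λ ζ θ) := fun θ =>
      ((measurable_wilsonAction r.ρ r.continuous).comp (measurable_glueWith Λ θ)).const_mul _
    have hSb : ∀ (θ : GaugeConfig 4 L G) (ζ : ↥Λ → G),
        |-β * wilsonAction r.ρ (glueWith Λ ζ θ)| ≤ |β| * C := fun θ ζ => by
      rw [abs_mul, abs_neg]; exact mul_le_mul_of_nonneg_left (hC _) (abs_nonneg β)
    have hpc : ∀ ζ : ↥Λ → G, |-β * wilsonAction r.ρ (glueWith Λ ζ η) -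
        -β * wilsonAction r.ρ (glueWith Λ ζ η'')| ≤ |β| * (P * s) := by
      intro ζ
      rw [← mul_sub, abs_mul, abs_neg]
      refine mul_le_mul_of_nonneg_left ?_ (abs_nonneg β)
      have h := abs_wilsonAction_sub_le r
        (Y := Finset.univ.filter fun e : Edge 4 L => cellOf q e = y)
        (U := glueWith Λ ζ η) (V := glueWith Λ ζ η'') (s := s) ?_ ?_
      · exact h.trans (mul_le_mul_of_nonneg_right hP hs0)
      · intro e he
        have he' : cellOf q e ≠ y := fun h' => he (Finset.mem_filter.2 ⟨Finset.mem_univ _, h'⟩)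
        by_cases heΛ : e ∈ Λ
        · rw [glueWith_apply_mem _ _ _ heΛ, glueWith_apply_mem _ _ _ heΛ]
        · rw [glueWith_apply_not_mem _ _ _ heΛ, glueWith_apply_not_mem _ _ _ heΛ]; exact hoff e he'
      · intro e
        by_cases heΛ : e ∈ Λ
        · rw [glueWith_apply_mem _ _ _ heΛ, glueWith_apply_mem _ _ _ heΛ, repDist_self]; exact hs0
        · rw [glueWith_apply_not_mem _ _ _ heΛ, glueWith_apply_not_mem _ _ _ heΛ]
          by_cases hey : cellOf q e = y
          · exact hse e hey
          · rw [← hoff e hey, repDist_self]; exact hs0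
    refine (abs_gibbsRatio_sub_le_linear (Measure.pi fun _ : ↥Λ => haarProbability G) (hSm η)
      (hSm η'') (hf.comp (measurable_glueWith Λ η)) (hSb η) (hSb η'') (fun ζ => hfb _) hpc).trans ?_
    calc 4 * Real.exp 2 * B * (|β| * (P * s))
        ≤ 4 * Real.exp 2 * B * (|β| * (P * (D + ε))) := by gcongr
      _ = Cst * (D + ε) := by simp only [hCst]; ring
  -- hence `|Δ| ≤ Cst · cellDev`
  have hCD : |windowAvg (torusYM r.ρ β L) Λ f η - windowAvg (torusYM r.ρ β L) Λ f η'| ≤ Cst * D := by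
    refine le_of_forall_pos_le_add fun ε hε => ?_
    have h := key (ε / (Cst + 1)) (by positivity)
    calc _ ≤ Cst * (D + ε / (Cst + 1)) := h
      _ = Cst * D + Cst / (Cst + 1) * ε := by ring
      _ ≤ Cst * D + 1 * ε := by
          gcongr
          exact (div_le_one (by positivity)).2 (by linarith)
      _ = Cst * D + ε := by ring
  -- and the trivial bound `2B`
  have h2B : |windowAvg (torusYM r.ρ β L) Λ f η - windowAvg (torusYM r.ρ β L) Λ f η'| ≤ 2 * B :=
    (abs_sub _ _).trans (by
      linarith [abs_windowAvg_torusYM_le r β Λ hf hfb η, abs_windowAvg_torusYM_le r β Λ hf hfb η'])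
  have hX : 0 ≤ 2 * Real.exp 2 * |β| * α * P := by positivity
  show _ ≤ 2 * B * (1 + 2 * Real.exp 2 * |β| * α * P) * min 1 (D / α)
  rcases le_or_gt α D with hαD | hDα
  · rw [min_eq_left ((one_le_div hα).2 hαD), mul_one]
    exact h2B.trans (le_mul_of_one_le_right (by positivity) (by linarith))
  · rw [min_eq_right ((div_le_one hα).2 hDα.le)]
    calc _ ≤ Cst * D := hCD
      _ = (4 * Real.exp 2 * B * |β| * P * α) * (D / α) := by
          simp only [hCst]; field_simp
      _ ≤ _ := by
          refine mul_le_mul_of_nonneg_right ?_ (div_nonneg hD0 hα.le)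
          nlinarith [hB, hX]

omit [TopologicalSpace G] [IsTopologicalGroup G] [CompactSpace G] [MeasurableSpace G]
  [BorelSpace G] in
/-- **Cell size.** For axis frames of scale `b` every cell carries at most `4(2b)⁴` links, its
shadow has at most `5` times as many sites, each the base of `6` plaquettes:
`4·#{plaquettes based in the shadow of a cell} ≤ 7680 b⁴`. -/
theorem plaqCount_le {b : ℕ} {q : (i : Fin 4) → ZMod L → ZMod (μ i + 1)}
    (hq : ∀ i, IsTorusFrame L b (q i)) (y : CoarseIdx μ) :
    4 * (Finset.univ.filter fun p : Plaquette 4 L =>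
      p.1 ∈ edgeShadow (Finset.univ.filter fun e : Edge 4 L => cellOf q e = y)).card ≤ 7680 * b ^ 4 := by
  classical
  have hplanes : Fintype.card {pl : Fin 4 × Fin 4 // pl.1 < pl.2} = 6 := by decide
  set Y := Finset.univ.filter fun e : Edge 4 L => cellOf q e = y with hY
  have hfib : ∀ i, (Finset.univ.filter fun z : ZMod L => q i z = y i).card ≤ 2 * b := fun i => by
    obtain ⟨a, ℓ, -, hℓ, hiff⟩ := (hq i).2 (y i)
    exact (StubTorusFrames.card_fibre_le (q i) (y i) a ℓ hiff).trans hℓ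
  have hYcard : Y.card ≤ 4 * (2 * b) ^ 4 := by
    have hsub : Y ⊆ (Fintype.piFinset fun i => Finset.univ.filter fun z : ZMod L => q i z = y i) ×ˢ
        (Finset.univ : Finset (Fin 4)) := by
      intro e he
      rw [Finset.mem_product, Fintype.mem_piFinset]
      refine ⟨fun i => Finset.mem_filter.2 ⟨Finset.mem_univ _, ?_⟩, Finset.mem_univ _⟩
      exact congrFun (Finset.mem_filter.1 he).2 i
    calc Y.card ≤ _ := Finset.card_le_card hsub
      _ = (∏ i, (Finset.univ.filter fun z : ZMod L => q i z = y i).card) * 4 := by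
          rw [Finset.card_product, Fintype.card_piFinset, Finset.card_univ, Fintype.card_fin]
      _ ≤ (2 * b) ^ 4 * 4 := by
          refine Nat.mul_le_mul_right _ ?_
          calc _ ≤ (2 * b) ^ (Finset.univ : Finset (Fin 4)).card :=
                Finset.prod_le_pow_card _ _ _ fun i _ => hfib i
            _ = (2 * b) ^ 4 := by rw [Finset.card_univ, Fintype.card_fin]
      _ = 4 * (2 * b) ^ 4 := by ring
  have hfilter : (Finset.univ.filter fun p : Plaquette 4 L => p.1 ∈ edgeShadow Y) =
      edgeShadow Y ×ˢ Finset.univ := by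
    ext p; simp
  rw [hfilter, Finset.card_product, Finset.card_univ]
  have h1 := card_edgeShadow_le Y
  rw [hplanes]
  calc 4 * ((edgeShadow Y).card * 6) ≤ 4 * (Y.card * (4 + 1) * 6) := by gcongr
    _ ≤ 4 * (4 * (2 * b) ^ 4 * 5 * 6) := by gcongr
    _ = 7680 * b ^ 4 := by ring

/-- **TV-Lipschitz bound for frames of scale `b`** (`abs_windowAvg_sub_le_orbitWeight` with
`plaqCount_le`): `|γ_Λ f(η) − γ_Λ f(η')| ≤ 2B(1 + 2e²|β|α·7680 b⁴) · orbitWeight r α q y η η'`. -/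
theorem abs_windowAvg_sub_le_orbitWeight_frame (β α : ℝ) (hα : 0 < α) {b : ℕ}
    (q : (i : Fin 4) → ZMod L → ZMod (μ i + 1)) (hq : ∀ i, IsTorusFrame L b (q i))
    (Λ : Finset (Edge 4 L)) (y : CoarseIdx μ) (hy : ∀ e ∈ Λ, cellOf q e ≠ y)
    {f : GaugeConfig 4 L G → ℝ} (hf : Measurable f) (hfdep : DependsOn f (↑Λ : Set (Edge 4 L)))
    {B : ℝ} (hfb : ∀ U, |f U| ≤ B) (η η' : GaugeConfig 4 L G)
    (hηη' : ∀ e, cellOf q e ≠ y → η e = η' e) :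
    |windowAvg (torusYM r.ρ β L) Λ f η - windowAvg (torusYM r.ρ β L) Λ f η'| ≤
      2 * B * (1 + 2 * Real.exp 2 * |β| * α * (7680 * (b : ℝ) ^ 4)) * orbitWeight r α q y η η' := by
  classical
  refine abs_windowAvg_sub_le_orbitWeight r β α hα q Λ y hy ?_ hf hfdep hfb η η' hηη'
  exact_mod_cast plaqCount_le hq y

end OrbitLip

end SlabClustering

end

end Summit.QuantumFields.YangMills.Cruxes.LatticeGapOnTrajectory.OrbitKantorovichFiniteSize
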